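import Mathlib.Topology.MetricSpace.Pseudo.Defs
import Mathlib.Algebra.Order.BigOperators.Group.Finset
import Mathlib.Data.Nat.Find
import HarnessLib

/-!
# Decoding a closed orbit of a local semiflow from a transit-time schedule

Topic `Literature/Dynamics/Hyperbolic`.  Elementary, fully proved bookkeeping (no definitions, no named facts) for the LAST
step of every closing lemma for (semi)flows — Anosov closing / Bowen's closing of pseudo-orbits of flows (Pilyugin 1999
§1.5), Katok's closing lemma for hyperbolic measures (Katok 1980 §3; Barreira–Pesin 2023 §11.2) in its semiflow form
(Lian–Young 2012) — namely the passage

  "points `y₀, …, yₙ` on local sections with `g (τⱼ) yⱼ = yⱼ₊₁`, transit times `τⱼ ≈ 1`, `yₙ = y₀`, each `yⱼ` close to the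
   reference orbit point `g j x₀`"  ⟹  "a CLOSED ORBIT `g T y₀ = y₀` of period `T = Σ τⱼ ≈ n` staying in the domain `U`, whose
   points at the INTEGER times `k ≤ n` are close to `g k x₀`",

for a map `g : ℝ → X → X` on a (pseudo)metric space `X` which is a LOCAL semiflow on a set `U` in the sense of
`Literature.Dynamics.Hyperbolic.IsHyperbolicSemiflowModel` (`g 0 = id` on `U`; `g (s + t) x = g s (g t x)` along orbit pieces
`g [0, t] x ⊆ U`), with hypotheses of exactly that shape so that the consumer (`HasAmbientClosing`) can feed the structure fields:

* §1 schedules `T 0 = 0`, `T (j+1) = T j + τ j`: `T j = Σ_{i<j} τ i`, the drift bound `|T j − j| ≤ Σ_{i<j} |τ i − 1|`,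
  monotonicity and positivity;
* §2 `apply_schedule_eq_and_mem`, `apply_add_schedule_eq` — CONCATENATION under the local semigroup law: if the pieces
  `g [0, τ j] (y j)` lie in `U` and `g (τ j) (y j) = y (j+1)` then `g (T j) (y 0) = y j`, the orbit `g [0, T n] (y 0)` lies in
  `U`, and `g (s + T j) (y 0) = g s (y j)` for `s ≥ 0`; with `y n = y 0` the orbit is closed (`apply_schedule_eq_self`);
* §3 EQUAL-INTEGER-TIME SHADOWING.  `dist_apply_natCast_le_of_time_lipschitz`: if the orbit of `z` is `W`-Lipschitz in time
  then `dist (g k z) (g k x₀) ≤ W·A + b` (`A` = schedule drift, `b` = section closeness).  `dist_apply_natCast_le_of_schedule`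
  (the form a `C¹`-in-`(0,2) × U` semiflow model can feed, no time-regularity of the NEW orbit needed): locate `k − c` in the
  schedule (`T j ≤ k − c`, last such `j ≤ n`), write `g k z = g s (y j)` with an elapsed time `s ∈ [c, c + 1 + A]`, compare
  with `g s (g j x₀) = g (s + j) x₀` through a closeness hypothesis for the maps `g s`, `s ∈ [c, S]`, at the reference points,
  and with `g k x₀` through a time-Lipschitz bound `V` of the REFERENCE orbit: `dist (g k z) (g k x₀) ≤ β + V·A`
  (`…_of_schedule_of_lipschitz`: `β = L·b` under an `L`-Lipschitz bound of `g s` at the reference points);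
* §4 `exists_closedOrbit_of_transitSchedule` — the assembly, with conclusion literally in the shape of
  `Literature.Dynamics.Hyperbolic.HasAmbientClosing`: `y 0 ∈ U ∧ ∃ T, 0 < T ∧ |T − n| ≤ A ∧ (∀ t ∈ Icc 0 T, g t (y 0) ∈ U) ∧
  g T (y 0) = y 0 ∧ ∀ k ≤ n, dist (g k (y 0)) (g k x₀) ≤ ε`.

Design: the offset `c ∈ [0, 1]` lets the consumer compare only maps `g s` with `s ≥ c > 0` (where a semiflow that is `C¹` on
`(0, 2) × U` but merely continuous on `[0, 2] × U` has space-Lipschitz bounds); all elapsed times used are `≤ c + 1 + A ≤ S`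
(`A < 1` the total drift), so `S < 2` is available for `c = 1/2`, `A ≤ 1/4`.  Nothing here is specific to hyperbolicity, charts
or Hilbert spaces; companion files: `TransitTimeSchedules.lean` (`ℤ`-indexed schedules under a Lipschitz roof function),
`SemiflowPoincareMap.lean` (transit times / Poincaré maps producing the `τ j`, `y j`), `SequenceShadowingPeriodic.lean`
(the periodic shadow producing the chart coordinates of the `y j`).

## References

* A. Katok, *Lyapunov exponents, entropy and periodic orbits for diffeomorphisms*, Publ. Math. IHÉS 51 (1980) 137–173, §3
  (Main Lemma: closing of returns to Pesin sets). [Katok1980]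
* S. Yu. Pilyugin, *Shadowing in Dynamical Systems*, LNM 1706, Springer (1999), §1.5 (shadowing and closing for flows via
  sections and reparametrisation). [Pilyugin1999]
* L. Barreira, Ya. Pesin, *Introduction to Smooth Ergodic Theory*, 2nd ed., GSM 231, AMS (2023), §11.2. [BarreiraPesin2023]
-/

noncomputable section

open Set Finset

namespace Literature.Dynamics.Hyperbolic

/-! ## §1 Schedules generated by transit times -/

section Schedule

variable {T τ : ℕ → ℝ}

/-- A schedule with steps `τ`: `T j = T 0 + Σ_{i<j} τ i`. [folklore] -/
theorem eq_add_sum_range_of_succ_eq_add (hs : ∀ j, T (j + 1) = T j + τ j) (j : ℕ) :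
    T j = T 0 + ∑ i ∈ range j, τ i := by
  induction j with
  | zero => simp
  | succ j ih => rw [hs, ih, sum_range_succ, add_assoc]

/-- A schedule from `T 0 = 0` with steps `τ` is the partial sum `T j = Σ_{i<j} τ i`. [folklore] -/
theorem eq_sum_range_of_succ_eq_add (h0 : T 0 = 0) (hs : ∀ j, T (j + 1) = T j + τ j) (j : ℕ) :
    T j = ∑ i ∈ range j, τ i := by
  rw [eq_add_sum_range_of_succ_eq_add hs j, h0, zero_add]

/-- **Schedule drift from unit transit times**: `|T j − j| ≤ Σ_{i<j} |τ i − 1|` for a schedule from `T 0 = 0`. [folklore] -/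
theorem abs_sub_natCast_le_sum_of_succ_eq_add (h0 : T 0 = 0) (hs : ∀ j, T (j + 1) = T j + τ j) (j : ℕ) :
    |T j - j| ≤ ∑ i ∈ range j, |τ i - 1| := by
  have h : T j - j = ∑ i ∈ range j, (τ i - 1) := by
    rw [eq_sum_range_of_succ_eq_add h0 hs j, sum_sub_distrib]
    simp
  rw [h]
  exact abs_sum_le_sum_abs _ _

/-- The drift over the first `j ≤ n` steps is at most the total drift `A ≥ Σ_{i<n} |τ i − 1|`. [folklore] -/
theorem abs_sub_natCast_le_of_succ_eq_add (h0 : T 0 = 0) (hs : ∀ j, T (j + 1) = T j + τ j) {n : ℕ} {A : ℝ}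
    (hA : ∑ i ∈ range n, |τ i - 1| ≤ A) {j : ℕ} (hj : j ≤ n) : |T j - j| ≤ A :=
  (abs_sub_natCast_le_sum_of_succ_eq_add h0 hs j).trans
    ((sum_le_sum_of_subset_of_nonneg (range_mono hj) fun _ _ _ => abs_nonneg _).trans hA)

/-- A single transit time deviates from `1` by at most the total drift: `|τ j − 1| ≤ A` for `j < n`. [folklore] -/
theorem abs_sub_one_le_of_sum_le {n : ℕ} {A : ℝ} (hA : ∑ i ∈ range n, |τ i - 1| ≤ A) {j : ℕ} (hj : j < n) :
    |τ j - 1| ≤ A :=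
  (single_le_sum (f := fun i => |τ i - 1|) (fun _ _ => abs_nonneg _) (mem_range.2 hj)).trans hA

/-- Hence `τ j ∈ [1 − A, 1 + A]` for `j < n`. [folklore] -/
theorem transit_mem_Icc_of_sum_le {n : ℕ} {A : ℝ} (hA : ∑ i ∈ range n, |τ i - 1| ≤ A) {j : ℕ} (hj : j < n) :
    τ j ∈ Icc (1 - A) (1 + A) := by
  have h := abs_le.1 (abs_sub_one_le_of_sum_le hA hj)
  constructor <;> linarith [h.1, h.2]

/-- A schedule with non-negative steps below `n` is monotone up to `n`: `T i ≤ T j` for `i ≤ j ≤ n`. [folklore] -/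
theorem schedule_mono (hs : ∀ j, T (j + 1) = T j + τ j) {n : ℕ} (hτ : ∀ j < n, 0 ≤ τ j) {i j : ℕ}
    (hij : i ≤ j) (hjn : j ≤ n) : T i ≤ T j := by
  induction j with
  | zero => rw [Nat.le_zero.1 hij]
  | succ j ih =>
    rcases Nat.lt_or_ge i (j + 1) with h | h
    · exact (ih (Nat.lt_succ_iff.1 h) (Nat.le_of_succ_le hjn)).trans (by rw [hs]; linarith [hτ j hjn])
    · rw [le_antisymm hij h]

/-- In particular a schedule from `T 0 = 0` with non-negative steps is non-negative up to `n`. [folklore] -/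
theorem schedule_nonneg (h0 : T 0 = 0) (hs : ∀ j, T (j + 1) = T j + τ j) {n : ℕ} (hτ : ∀ j < n, 0 ≤ τ j) {j : ℕ}
    (hjn : j ≤ n) : 0 ≤ T j :=
  h0.symm.le.trans (schedule_mono hs hτ (Nat.zero_le j) hjn)

/-- **Positivity of the period**: with total drift `A < 1` and `n ≥ 1` steps, `0 < T n` (indeed `n − A ≤ T n`). [folklore] -/
theorem schedule_pos (h0 : T 0 = 0) (hs : ∀ j, T (j + 1) = T j + τ j) {n : ℕ} {A : ℝ}
    (hA : ∑ i ∈ range n, |τ i - 1| ≤ A) (hA1 : A < 1) (hn : 0 < n) : 0 < T n := by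
  have h := (abs_le.1 (abs_sub_natCast_le_of_succ_eq_add h0 hs hA le_rfl)).1
  have hn1 : (1 : ℝ) ≤ n := by exact_mod_cast hn
  linarith

end Schedule

/-! ## §2 Concatenating orbit pieces under a local semigroup law -/

section LocalSemiflow

variable {X : Type*} {g : ℝ → X → X} {U : Set X} {y : ℕ → X} {τ T : ℕ → ℝ} {n : ℕ}

/-- **Concatenation of orbit pieces.**  Let `g` be a local semiflow on `U` (`g 0 = id` on `U`, `g (s + t) x = g s (g t x)`
whenever `s, t ≥ 0`, `x ∈ U` and `g [0, t] x ⊆ U` — the fields `map_zero`, `map_add` of `IsHyperbolicSemiflowModel`), `y 0 ∈ U`,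
and for `j < n` let the piece `g [0, τ j] (y j)` (`τ j ≥ 0`) lie in `U` and end at `g (τ j) (y j) = y (j + 1)`.  Then along the
schedule `T 0 = 0`, `T (j+1) = T j + τ j`: `g (T j) (y 0) = y j` for `j ≤ n`, and the whole orbit piece `g [0, T n] (y 0)` lies
in `U`. [folklore] -/
theorem apply_schedule_eq_and_mem (hzero : ∀ x ∈ U, g 0 x = x)
    (hadd : ∀ s t : ℝ, 0 ≤ s → 0 ≤ t → ∀ x ∈ U, (∀ r ∈ Icc 0 t, g r x ∈ U) → g (s + t) x = g s (g t x))
    (h0 : T 0 = 0) (hs : ∀ j, T (j + 1) = T j + τ j) (hτ : ∀ j < n, 0 ≤ τ j) (hy0 : y 0 ∈ U)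
    (hU : ∀ j < n, ∀ s ∈ Icc 0 (τ j), g s (y j) ∈ U) (hstep : ∀ j < n, g (τ j) (y j) = y (j + 1)) :
    (∀ j ≤ n, g (T j) (y 0) = y j) ∧ ∀ t ∈ Icc 0 (T n), g t (y 0) ∈ U := by
  -- induction on `j ≤ n` with both clauses at once
  have key : ∀ j ≤ n, g (T j) (y 0) = y j ∧ ∀ t ∈ Icc 0 (T j), g t (y 0) ∈ U := by
    intro j
    induction j with
    | zero =>
      intro _
      refine ⟨by rw [h0, hzero _ hy0], fun t ht => ?_⟩
      rw [h0] at ht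
      rw [le_antisymm ht.2 ht.1, hzero _ hy0]
      exact hy0
    | succ j ih =>
      intro hj
      have hjn : j < n := hj
      obtain ⟨ihj, ihU⟩ := ih hjn.le
      have hTj : 0 ≤ T j := schedule_nonneg h0 hs hτ hjn.le
      -- the semigroup law based at time `T j`
      have hsg : ∀ s : ℝ, 0 ≤ s → g (s + T j) (y 0) = g s (y j) := fun s hs0 => by
        rw [hadd s (T j) hs0 hTj (y 0) hy0 ihU, ihj]
      refine ⟨?_, fun t ht => ?_⟩
      · rw [hs, add_comm, hsg _ (hτ j hjn), hstep j hjn]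
      · rcases le_or_gt t (T j) with h | h
        · exact ihU t ⟨ht.1, h⟩
        · have ht' : t = (t - T j) + T j := by ring
          rw [ht', hsg _ (by linarith)]
          exact hU j hjn _ ⟨by linarith, by rw [hs] at ht; linarith [ht.2]⟩
  exact ⟨fun j hj => (key j hj).1, (key n le_rfl).2⟩

/-- **Restarting the clock at a section time**: under the hypotheses of `apply_schedule_eq_and_mem`,
`g (s + T j) (y 0) = g s (y j)` for all `j ≤ n` and `s ≥ 0`. [folklore] -/
theorem apply_add_schedule_eq (hzero : ∀ x ∈ U, g 0 x = x)
    (hadd : ∀ s t : ℝ, 0 ≤ s → 0 ≤ t → ∀ x ∈ U, (∀ r ∈ Icc 0 t, g r x ∈ U) → g (s + t) x = g s (g t x))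
    (h0 : T 0 = 0) (hs : ∀ j, T (j + 1) = T j + τ j) (hτ : ∀ j < n, 0 ≤ τ j) (hy0 : y 0 ∈ U)
    (hU : ∀ j < n, ∀ s ∈ Icc 0 (τ j), g s (y j) ∈ U) (hstep : ∀ j < n, g (τ j) (y j) = y (j + 1))
    {j : ℕ} (hj : j ≤ n) {s : ℝ} (hs0 : 0 ≤ s) : g (s + T j) (y 0) = g s (y j) := by
  obtain ⟨hT, hmem⟩ := apply_schedule_eq_and_mem hzero hadd h0 hs hτ hy0 hU hstep
  have hTj : 0 ≤ T j := schedule_nonneg h0 hs hτ hj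
  have hjn : T j ≤ T n := schedule_mono hs hτ hj le_rfl
  rw [hadd s (T j) hs0 hTj (y 0) hy0 (fun r hr => hmem r ⟨hr.1, hr.2.trans hjn⟩), hT j hj]

/-- **Closing up**: if moreover `y n = y 0`, the orbit of `y 0` is CLOSED with period `T n` — `g (T n) (y 0) = y 0` and
`g (t + T n) (y 0) = g t (y 0)` for `t ≥ 0`. [folklore] -/
theorem apply_schedule_eq_self (hzero : ∀ x ∈ U, g 0 x = x)
    (hadd : ∀ s t : ℝ, 0 ≤ s → 0 ≤ t → ∀ x ∈ U, (∀ r ∈ Icc 0 t, g r x ∈ U) → g (s + t) x = g s (g t x))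
    (h0 : T 0 = 0) (hs : ∀ j, T (j + 1) = T j + τ j) (hτ : ∀ j < n, 0 ≤ τ j) (hy0 : y 0 ∈ U)
    (hU : ∀ j < n, ∀ s ∈ Icc 0 (τ j), g s (y j) ∈ U) (hstep : ∀ j < n, g (τ j) (y j) = y (j + 1))
    (hper : y n = y 0) :
    g (T n) (y 0) = y 0 ∧ ∀ t : ℝ, 0 ≤ t → g (t + T n) (y 0) = g t (y 0) := by
  refine ⟨?_, fun t ht => ?_⟩
  · rw [(apply_schedule_eq_and_mem hzero hadd h0 hs hτ hy0 hU hstep).1 n le_rfl, hper]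
  · rw [apply_add_schedule_eq hzero hadd h0 hs hτ hy0 hU hstep le_rfl ht, hper]

end LocalSemiflow

/-! ## §3 Equal-integer-time shadowing -/

section IntegerTimes

variable {X : Type*} [PseudoMetricSpace X] {g : ℝ → X → X} {x₀ z : X} {y : ℕ → X} {τ T : ℕ → ℝ} {n : ℕ}

/-- **Integer-time comparison through time-regularity of the NEW orbit.**  If the orbit of `z` is `W`-Lipschitz in time,
passes through `y j = g (T j) z` at the section times, the schedule drifts by at most `A` (`|T j − j| ≤ A`) and the section
points are `b`-close to the reference orbit (`dist (y j) (g j x₀) ≤ b`), then `dist (g k z) (g k x₀) ≤ W·A + b` for every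
integer time `k ≤ n`. [folklore] -/
theorem dist_apply_natCast_le_of_time_lipschitz {A W b : ℝ} (hT : ∀ j ≤ n, 0 ≤ T j) (hTA : ∀ j ≤ n, |T j - j| ≤ A)
    (hz_lip : ∀ s t : ℝ, 0 ≤ s → 0 ≤ t → dist (g s z) (g t z) ≤ W * |s - t|)
    (hzT : ∀ j ≤ n, g (T j) z = y j) (hb : ∀ j ≤ n, dist (y j) (g j x₀) ≤ b) {k : ℕ} (hk : k ≤ n) :
    dist (g k z) (g k x₀) ≤ W * A + b := by
  have hW : 0 ≤ W := by simpa using (dist_nonneg.trans (hz_lip 0 1 le_rfl zero_le_one))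
  calc dist (g k z) (g k x₀) ≤ dist (g k z) (g (T k) z) + dist (g (T k) z) (g k x₀) := dist_triangle _ _ _
    _ ≤ W * |(k : ℝ) - T k| + b := by
        refine add_le_add (hz_lip _ _ k.cast_nonneg (hT k hk)) ?_
        rw [hzT k hk]
        exact hb k hk
    _ ≤ W * A + b := by
        rw [abs_sub_comm]
        exact add_le_add (mul_le_mul_of_nonneg_left (hTA k hk) hW) le_rfl

/-- **Integer-time comparison through the reference flow (Katok / Lian–Young decoding).**  Data: a schedule `T 0 = 0`,
`T (j+1) = T j + τ j` of total drift `Σ_{j<n} |τ j − 1| ≤ A`; an offset `c ≥ 0` and a horizon `S ≥ c + 1 + A`; the REFERENCE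
orbit of `x₀` satisfies the semigroup law and is `V`-Lipschitz in time; the NEW orbit restarts at the section points,
`g (s + T j) z = g s (y j)` for `s ∈ [c, S]`, `j ≤ n` (cf. `apply_add_schedule_eq`); and the maps `g s`, `s ∈ [c, S]`, keep
`y j` within `β` of the reference: `dist (g s (y j)) (g s (g j x₀)) ≤ β`.  Then for every integer time `k ∈ [c, n]`,
`dist (g k z) (g k x₀) ≤ β + V·A`.  Proof: with `j ≤ n` the last index with `T j ≤ k − c` and `s := k − T j ∈ [c, S]`,
`g k z = g s (y j)` is `β`-close to `g s (g j x₀) = g (s + j) x₀`, which is `V|T j − j|`-close to `g k x₀`. [folklore] -/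
theorem dist_apply_natCast_le_of_schedule {A c S V β : ℝ} (h0 : T 0 = 0) (hs : ∀ j, T (j + 1) = T j + τ j)
    (hA : ∑ j ∈ range n, |τ j - 1| ≤ A) (hc : 0 ≤ c) (hS : c + 1 + A ≤ S)
    (hx_add : ∀ s t : ℝ, 0 ≤ s → 0 ≤ t → g (s + t) x₀ = g s (g t x₀))
    (hx_lip : ∀ s t : ℝ, 0 ≤ s → 0 ≤ t → dist (g s x₀) (g t x₀) ≤ V * |s - t|)
    (hz_add : ∀ j ≤ n, ∀ s ∈ Icc c S, g (s + T j) z = g s (y j))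
    (hloc : ∀ j ≤ n, ∀ s ∈ Icc c S, dist (g s (y j)) (g s (g j x₀)) ≤ β)
    {k : ℕ} (hck : c ≤ k) (hkn : k ≤ n) :
    dist (g k z) (g k x₀) ≤ β + V * A := by
  classical
  have hV : 0 ≤ V := by simpa using (dist_nonneg.trans (hx_lip 0 1 le_rfl zero_le_one))
  -- locate `k - c` in the schedule: `j` is the last index `≤ n` with `T j ≤ k - c`
  set P : ℕ → Prop := fun j => T j ≤ (k : ℝ) - c with hP
  set j : ℕ := Nat.findGreatest P n with hjdef
  have hjn : j ≤ n := Nat.findGreatest_le n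
  have hP0 : P 0 := by simp only [hP, h0]; linarith
  have hPj : P j := Nat.findGreatest_spec (Nat.zero_le n) hP0
  have hTj : T j ≤ (k : ℝ) - c := hPj
  -- the elapsed time since the section time `T j`
  set s : ℝ := (k : ℝ) - T j with hsdef
  have hcs : c ≤ s := by simp only [hsdef]; linarith
  have hdrift : |T j - j| ≤ A := abs_sub_natCast_le_of_succ_eq_add h0 hs hA hjn
  have hsS : s ≤ S := by
    rcases hjn.lt_or_eq with hlt | heq
    · -- `j < n`: the next section time is beyond `k - c`, so `s < c + τ j ≤ c + 1 + A`
      have hnot : ¬P (j + 1) := Nat.findGreatest_is_greatest (Nat.lt_succ_self j) (Nat.succ_le_of_lt hlt)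
      have hlt' : (k : ℝ) - c < T (j + 1) := lt_of_not_ge hnot
      have hτj := (transit_mem_Icc_of_sum_le hA hlt).2
      rw [hs] at hlt'
      simp only [hsdef]
      linarith
    · -- `j = n`: `s = k - T n ≤ n - T n ≤ A`
      have hkn' : (k : ℝ) ≤ n := by exact_mod_cast hkn
      have h1 := (abs_le.1 hdrift).1
      rw [heq] at h1
      simp only [hsdef, heq]
      linarith
  have hsI : s ∈ Icc c S := ⟨hcs, hsS⟩
  have hs0 : 0 ≤ s := hc.trans hcs
  -- `g k z = g s (y j)`
  have h1 : g k z = g s (y j) := by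
    rw [← hz_add j hjn s hsI, hsdef, sub_add_cancel]
  -- `g s (g j x₀) = g (s + j) x₀`, at time distance `|T j - j|` from `k`
  have h2 : g s (g j x₀) = g (s + j) x₀ := (hx_add s j hs0 j.cast_nonneg).symm
  have h3 : dist (g (s + j) x₀) (g k x₀) ≤ V * A := by
    refine (hx_lip _ _ (add_nonneg hs0 j.cast_nonneg) k.cast_nonneg).trans ?_
    have : s + j - k = -(T j - j) := by simp only [hsdef]; ring
    rw [this, abs_neg]
    exact mul_le_mul_of_nonneg_left hdrift hV
  calc dist (g k z) (g k x₀) ≤ dist (g k z) (g s (g j x₀)) + dist (g s (g j x₀)) (g k x₀) := dist_triangle _ _ _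
    _ ≤ β + V * A := by
        rw [h1, h2]
        refine add_le_add ?_ h3
        rw [← h2]
        exact hloc j hjn s hsI

/-- The same with the closeness hypothesis in LIPSCHITZ form: if the maps `g s`, `s ∈ [c, S]`, satisfy
`dist (g s (y j)) (g s (g j x₀)) ≤ L · dist (y j) (g j x₀)` (`L ≥ 0`; e.g. `L` a Lipschitz constant of `g s` on balls at the
reference points) and `dist (y j) (g j x₀) ≤ b`, then `dist (g k z) (g k x₀) ≤ L·b + V·A` for integer `k ∈ [c, n]`. [folklore] -/
theorem dist_apply_natCast_le_of_schedule_of_lipschitz {A c S V L b : ℝ} (h0 : T 0 = 0)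
    (hs : ∀ j, T (j + 1) = T j + τ j) (hA : ∑ j ∈ range n, |τ j - 1| ≤ A) (hc : 0 ≤ c) (hS : c + 1 + A ≤ S)
    (hx_add : ∀ s t : ℝ, 0 ≤ s → 0 ≤ t → g (s + t) x₀ = g s (g t x₀))
    (hx_lip : ∀ s t : ℝ, 0 ≤ s → 0 ≤ t → dist (g s x₀) (g t x₀) ≤ V * |s - t|)
    (hz_add : ∀ j ≤ n, ∀ s ∈ Icc c S, g (s + T j) z = g s (y j)) (hL : 0 ≤ L)
    (hlip : ∀ j ≤ n, ∀ s ∈ Icc c S, dist (g s (y j)) (g s (g j x₀)) ≤ L * dist (y j) (g j x₀))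
    (hb : ∀ j ≤ n, dist (y j) (g j x₀) ≤ b) {k : ℕ} (hck : c ≤ k) (hkn : k ≤ n) :
    dist (g k z) (g k x₀) ≤ L * b + V * A :=
  dist_apply_natCast_le_of_schedule h0 hs hA hc hS hx_add hx_lip hz_add
    (fun j hj s hsI => (hlip j hj s hsI).trans (mul_le_mul_of_nonneg_left (hb j hj) hL)) hck hkn

end IntegerTimes

/-! ## §4 Assembly: a closed orbit in the shape of `HasAmbientClosing` -/

section Assembly

variable {X : Type*} [PseudoMetricSpace X] {g : ℝ → X → X} {U : Set X} {x₀ : X} {y : ℕ → X} {τ : ℕ → ℝ} {n : ℕ}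

/-- **Decoding a closed orbit from a transit schedule.**  Let `g` be a local semiflow on `U` (`map_zero`, `map_add` as in
`IsHyperbolicSemiflowModel`); let the reference orbit of `x₀` satisfy `g 0 x₀ = x₀`, the semigroup law and a time-Lipschitz
bound `V`; let `y 0, …, y n ∈ U` (`n ≥ 1`, `y n = y 0`) have orbit pieces `g [0, S] (y j) ⊆ U` and transit relations
`g (τ j) (y j) = y (j + 1)` (`j < n`) with total drift `Σ_{j<n} |τ j − 1| ≤ A < 1`; fix an offset `c ∈ [0, 1]` with
`c + 1 + A ≤ S`, and let the maps `g s`, `s ∈ [c, S]`, keep each `y j` within `β` of `g s (g j x₀)`.  If `β + V·A ≤ ε` and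
`dist (y 0) x₀ ≤ ε`, then `y 0 ∈ U` carries a CLOSED ORBIT of `g` inside `U` of period `T = Σ_{j<n} τ j`, `0 < T`, `|T − n| ≤ A`,
which `ε`-shadows the reference orbit at the integer times `k ≤ n` — the conclusion of `HasAmbientClosing` for the return of
`x₀`. [folklore] -/
theorem exists_closedOrbit_of_transitSchedule {A c S V β ε : ℝ} (hzero : ∀ x ∈ U, g 0 x = x)
    (hadd : ∀ s t : ℝ, 0 ≤ s → 0 ≤ t → ∀ x ∈ U, (∀ r ∈ Icc 0 t, g r x ∈ U) → g (s + t) x = g s (g t x))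
    (hn : 0 < n) (hA : ∑ j ∈ range n, |τ j - 1| ≤ A) (hA1 : A < 1) (hc : 0 ≤ c) (hc1 : c ≤ 1) (hS : c + 1 + A ≤ S)
    (hx0 : g 0 x₀ = x₀) (hx_add : ∀ s t : ℝ, 0 ≤ s → 0 ≤ t → g (s + t) x₀ = g s (g t x₀))
    (hx_lip : ∀ s t : ℝ, 0 ≤ s → 0 ≤ t → dist (g s x₀) (g t x₀) ≤ V * |s - t|)
    (hyU : ∀ j ≤ n, y j ∈ U) (hyS : ∀ j ≤ n, ∀ s ∈ Icc 0 S, g s (y j) ∈ U)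
    (hstep : ∀ j < n, g (τ j) (y j) = y (j + 1)) (hper : y n = y 0)
    (hloc : ∀ j ≤ n, ∀ s ∈ Icc c S, dist (g s (y j)) (g s (g j x₀)) ≤ β)
    (hε : β + V * A ≤ ε) (hε0 : dist (y 0) x₀ ≤ ε) :
    y 0 ∈ U ∧ ∃ T : ℝ, 0 < T ∧ |T - n| ≤ A ∧ (∀ t ∈ Icc 0 T, g t (y 0) ∈ U) ∧ g T (y 0) = y 0 ∧
      ∀ k : ℕ, k ≤ n → dist (g k (y 0)) (g k x₀) ≤ ε := by
  -- the schedule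
  set T : ℕ → ℝ := fun j => ∑ i ∈ range j, τ i with hTdef
  have h0 : T 0 = 0 := by simp [hTdef]
  have hs : ∀ j, T (j + 1) = T j + τ j := fun j => by simp [hTdef, sum_range_succ]
  have hτb : ∀ j < n, 1 - A ≤ τ j ∧ τ j ≤ 1 + A := fun j hj => transit_mem_Icc_of_sum_le hA hj
  have hτ : ∀ j < n, 0 ≤ τ j := fun j hj => by linarith [(hτb j hj).1]
  have hU : ∀ j < n, ∀ s ∈ Icc 0 (τ j), g s (y j) ∈ U := fun j hj s hsI =>
    hyS j hj.le s ⟨hsI.1, hsI.2.trans (by linarith [(hτb j hj).2])⟩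
  obtain ⟨hTy, hmem⟩ := apply_schedule_eq_and_mem hzero hadd h0 hs hτ (hyU 0 (Nat.zero_le n)) hU hstep
  have hclosed := (apply_schedule_eq_self hzero hadd h0 hs hτ (hyU 0 (Nat.zero_le n)) hU hstep hper).1
  have hz_add : ∀ j ≤ n, ∀ s ∈ Icc c S, g (s + T j) (y 0) = g s (y j) := fun j hj s hsI =>
    apply_add_schedule_eq hzero hadd h0 hs hτ (hyU 0 (Nat.zero_le n)) hU hstep hj (hc.trans hsI.1)
  refine ⟨hyU 0 (Nat.zero_le n), T n, schedule_pos h0 hs hA hA1 hn,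
    abs_sub_natCast_le_of_succ_eq_add h0 hs hA le_rfl, hmem, hclosed, fun k hk => ?_⟩
  rcases Nat.eq_zero_or_pos k with hk0 | hkpos
  · -- `k = 0`: both orbits start at their base points
    subst hk0
    rw [Nat.cast_zero, hzero _ (hyU 0 (Nat.zero_le n)), hx0]
    exact hε0
  · have hck : c ≤ k := hc1.trans (by exact_mod_cast hkpos)
    exact (dist_apply_natCast_le_of_schedule h0 hs hA hc hS hx_add hx_lip hz_add hloc hck hk).trans hε

end Assembly

end Literature.Dynamics.Hyperbolic

end
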